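import Summits.ResolutionOfSingularities.ResolutionOfSingularities.Theorems.HilbertSamuelEliminationSigmaMaxModificationsCorridor3WLadderIsoTailExtraction
import Summits.ResolutionOfSingularities.ResolutionOfSingularities.Theorems.HilbertSamuelEliminationSigmaMaxModificationsCorridor3WLadderMovingIso
import HarnessLib

/-!
# [OURS · L1 W4.2] The eventually-isolated half of the W-top rows from the ORACLE-FREE KERNEL ALONE (W4.2 DEAL D7 after-care;
# crux `SigmaMaxModifications` stmt-ResolutionOfSingularities-18506, conjunct `SigmaMaxModificationsCorridor3` stmt-…-19249;
# line `w_ladder` v6; `--supports stmt-ResolutionOfSingularities-19249`, helper)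

OURS (cell res-hironaka, slot W4.2, seat res-D-pv-042 AS W4.2 DEAL hand D7); NOT statements of H. Hironaka's manuscript
[Hironaka2017] nor of [CossartJannsenSaito2020]. AI-drafted, weaker than expert review. Sorry-free PROOF file (no new definition),
fact-free. With the extraction row `IsoTailTowerExtractionM p` now PROVED (`IdeasL1Idea2R4.isoTailTowerExtractionM_holds`, p514284),
res-L1-w42-idea-2's proved reductions of card G §3 (`…Corridor3WLadderMovingIso`) lose their extraction hypothesis:

* `wtopEvIsoM_of_isoQuadraticTowerTerminates : IsoQuadraticTowerTerminates p 3 → ∀ Q, WtopEvIsoM p Q` — the `EvIso` half of BOTH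
  registered W-top stubs is the oracle-free local kernel «isolated quadratic towers terminate» and nothing else;
* `wtop3NonpointedM_of_kernel_recNonIso`, `wtop3PointedM_of_kernel_recNonIso` — cover A of the two stubs from the kernel and the
  `Rec-NonIso` rows.

## References

* V. Cossart, U. Jannsen, S. Saito, LNM 2270 (2020): Def. 6.38, Thm. 6.40, Rem. 6.29 (1). [CossartJannsenSaito2020]
-/

noncomputable section

set_option linter.dupNamespace false

open CategoryTheory AlgebraicGeometry
open Summit.ResolutionOfSingularities.ResolutionOfSingularities.Theorems.SigmaMaxModificationsCorridor3.Moving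
open Summit.ResolutionOfSingularities.ResolutionOfSingularities.Theorems.SigmaMaxModificationsCorridor3.Helpers (QPointed)

universe u

namespace Summit.ResolutionOfSingularities.ResolutionOfSingularities.Cruxes.SigmaMaxModifications.IdeasL1Idea2R4

/-- **[OURS · L1 W4.2] The eventually-isolated half of both W-top rows is the oracle-free kernel alone**: if isolated quadratic
towers terminate at level `3` in characteristic `p`, then no moving E3 chain from any maximal origin is eventually isolated
(`wtopEvIsoM_of_towers` with the extraction discharged by `isoTailTowerExtractionM_holds`). NOT a statement of the manuscript.
[cite: CossartJannsenSaito2020, Def. 6.38, Thm. 6.40] -/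
theorem wtopEvIsoM_of_isoQuadraticTowerTerminates {p : ℕ} (hT : IsoQuadraticTowerTerminates.{u} p 3)
    (Q : ℕ → (ℕ → ℕ) → ∀ X : Scheme.{u}, X → Prop) : WtopEvIsoM.{u} p Q :=
  wtopEvIsoM_of_towers hT (isoTailTowerExtractionM_holds p) Q

/-- **Cover A of the non-pointed W-top stub from the kernel and `Rec-NonIso`** (extraction discharged). NOT a statement of the
manuscript. [cite: CossartJannsenSaito2020, Thm. 6.35, Thm. 6.40] -/
theorem wtop3NonpointedM_of_kernel_recNonIso {p : ℕ} (hT : IsoQuadraticTowerTerminates.{u} p 3)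
    (hrec : WtopRecNonIsoM.{u} p QNonpointed) : Wtop3NonpointedM.{u} p :=
  wtop3NonpointedM_of_towers_recNonIso hT (isoTailTowerExtractionM_holds p) hrec

/-- **Cover A of the pointed W-top stub from the kernel and `Rec-NonIso`** (extraction discharged). NOT a statement of the
manuscript. [cite: CossartJannsenSaito2020, Thm. 6.35, Thm. 6.40] -/
theorem wtop3PointedM_of_kernel_recNonIso {p : ℕ} (hT : IsoQuadraticTowerTerminates.{u} p 3)
    (hrec : WtopRecNonIsoM.{u} p QPointed) : Wtop3PointedM.{u} p :=
  wtop3PointedM_of_towers_recNonIso hT (isoTailTowerExtractionM_holds p) hrec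

end Summit.ResolutionOfSingularities.ResolutionOfSingularities.Cruxes.SigmaMaxModifications.IdeasL1Idea2R4

end
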